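import Summits.QuantumFields.BalabanUV.Beta.EriceRemainderEnclosureHistoryAutonomyComparisonAgeCompositionNestedMoments

/-!
# EriceRemainderEnclosureHistoryAutonomyComparisonAgeCompositionYoungPairMoment — (E94b) route (N), first order: THE YOUNG PAIR AGAINST THE OLD READ
# WITH THREE SHARP LETTERS — and the census three ages `{1, k₂, k₃}` at EVERY `k₃` for `2 ≤ k₂ ≤ 8`.  The wedge R2 of (E91c)∕(E94a) charges the
# young pair `{1, k₂}` at its share bound `σ = √2∕(1+p₀)` (up to `0.84`), the old age at `√2∕2`, and the old read's variation over the WHOLE pair window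
# (`4k₂c₃`).  Three letters are sharper, all [folklore] along every admissible flow:
# (i) THE OWN-WINDOW CAP: every age `k` has `x_k(m) ≤ √((3k+1)∕(8k))` (`0.6142` for `k ≥ 57`; the levels inside the age's window are bounded by the RAY
#     from the pin, `a_{m+k+t} ≤ (1+t∕k)·a_{m+k}`, and `Σ_{t∈(k,2k]} t^{-1∕2} ≥ k·((3k+1)∕2)^{-1∕2}` by the tangent of `t ↦ t^{-1∕2}`) — versus `√2∕2`;
# (ii) THE YOUNG-PAIR POLYTOPE: with `σ = h_{m+1}∕h_{m+k₂} ∈ [1, √k₂]`, the loads `x = x₁(m)`, `y = x_{k₂}(m)` satisfy the step letter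
#     `√2·x + (2ρ∕k₂)σ²·y ≤ 1` and the window letter `2(k₂−1+ρ)·x + ζσ³·y ≤ σ³` (`ρ² (k₂+1) ≤ k₂`, `ζ²(3k₂+1) ≤ 8k₂`) — whose joint maximum of `x + y`
#     is `≈ 0.71` for `k₂ ≤ 8`, versus the share bound `0.74 … 0.84`;
# (iii) THE FIRST MOMENT: the old read's variation is charged per lag against `Σ_l w_l(l+1) ≤ x + (k₂+1)y∕2` ((E92c) `residual_step_moment`), not against
#     `k₂(x+y)`.
# The END then follows at the pin from ONE linear inequality on the polytope, `(1−so)(x+y) + κ(x + (k₂+1)y∕2) ≤ 1 − so` (`κ ≥ 4so∕k₃`); its rational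
# certificates (thresholds `k₃ ≥ 18 … 46` for `k₂ = 2 … 8`, against `56 … 401` for (E94a)) and the closed rows `2 ≤ k₂ ≤ 8` are in the sequel (E94c)

Cell `pub-balaban`, β-function sub-cell, BINDER row D4 «RemainderConst leaves for Bałaban's split» (`HOME/BINDER-OWNERS.md`; owner lineage `b2b-balaban-beta-an4`;
this file by co-owner #2 lineage `b2b-balaban-beta-d4-p2`, generation 84), β-FLOW TEAM duty (1), FREEZE (0) honoured (def-free; nothing restated).

HONEST FRAMING (page 1, verbatim and binding).  *"Discharging BetaPertH makes Bałaban's UV stability UNCONDITIONAL — a real constructive-QFT result; it is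
NOT the continuum limit and NOT the Clay problem."*  THIS FILE DISCHARGES NOTHING OF THE KIND.  Elementary real algebra ∕ real analysis about ABSTRACT
functionals on a box ]0,γ]^ℕ with displayed floors, profiles and signs, and the FIRST-ORDER renewal objects of route (N) built from them — hypotheses of a
census, not facts; the form, signs, ages and moments of Bałaban's (1.22) limit functional are NOT PRINTED ([I] p. 298; GAPS G-t4-U2-1∕-2) and NOT asserted.
Row D4 class UNCHANGED (critical-path width 0; instance 0∕1; D4 DISCHARGE NO DATE).  HONEST DEPENDENCY: continuum YM on T⁴ ⇐ BetaPertH ∧ nine spine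
estimates (0/9 proved); BetaPertH ⇐ (D1) ∧ (D4) ∧ CAP+tail; G-an2-4 gates asym, D1 and NE2/3/4.

THE POINT (README `HOME/b2b-balaban-beta-d4-p2/g84/README.md` §2).  Numerics (`g84/numerics/`): the TRUE supremum of the young pair's load `x₁ + x_{k₂}`
along admissible flows is `0.7071` for `k₂ ≤ 8` (`0.72` at `16`); the old age's own window caps it at `0.61`; the old read moves by the pair's MOMENT.  Uses (E92c) `residual_step_moment`∕
`row_moment_le`∕`sum_range_succ_real`, (E92a) `renewal_bounds_of_step`, (E91a) `old_read_variation`, (E90b) `mul_sq_le_from_pin`, (E88d)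
`invSq_sub_ge_all_reads`, (E92b) `two_terms_le_reads`, (E82a) `kernel_entry_le`∕`row_mass_le`, (E80b) `aggregate_eq_sum`, (E90c) `flow_nonneg_three_ages`
BY NAME.  NOT CLAIMED: `k₂ ≥ 9` (the same letters give `k₃ ≥ 50∕55` for `k₂ = 9∕10` only with the exact sums `Σ t^{-1∕2}`, successor work; `k₂ ≥ 11`
needs the total-load certificate of README §3); anything printed — NOT B12 Thm 2, NOT BetaPertH, NOT continuum, NOT Clay.

WHAT IS PROVED ([folklore]; 0 `def`, 0 sorry).  §1 `cube_tangent_poly`, `tangent_term_le`, `sum_three_half_sub`, **`window_sum_ge`** (`c·k·h_{m+k} ≤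
Σ_{q<k} h_{m+k+1+q}` for `c²(3k+1) ≤ 2k`), **`load_le_of_sq`** (`x_k(m) ≤ so` whenever `8k·so² ≥ 3k+1`), **`young_pair_letters`** (the polytope (ii)).
§2 **`flow_nonneg_three_ages_young_pair_moment`** (parametric: `ρ, ζ, so, κ` and the displayed polytope inequality).  The rational certificates and the
rows `2 ≤ k₂ ≤ 8` are in the sequel (E94c) `…YoungPairMomentRows`.
-/
noncomputable section
open Finset

namespace Summit.QuantumFields.BalabanUV.Beta.EriceRemainderEnclosureHistoryAutonomyComparisonAgeCompositionYoungPairMoment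

open Literature.MathematicalPhysics.QuantumFieldTheory.Balaban1983to89
open Literature.MathematicalPhysics.QuantumFieldTheory.Balaban1983to89.T4BetaStationary
open Literature.MathematicalPhysics.QuantumFieldTheory.Balaban1983to89.T4BetaFlowWellPosed
open Summit.QuantumFields.BalabanUV.Beta.EriceRemainderEnclosureHistoryAutonomyOrder (strictAnti_of_memFlow)
open Summit.QuantumFields.BalabanUV.Beta.EriceRemainderEnclosureHistoryAutonomyComparisonAgeCompositionWindowShares (mul_sq_le_from_pin)
open Summit.QuantumFields.BalabanUV.Beta.EriceRemainderEnclosureHistoryAutonomyComparisonAgeCompositionThreeAgesFlowReads (invSq_sub_ge_all_reads)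
open Summit.QuantumFields.BalabanUV.Beta.EriceRemainderEnclosureHistoryAutonomyComparisonAgeCompositionPairShares (two_terms_le_reads)
open Summit.QuantumFields.BalabanUV.Beta.EriceRemainderEnclosureHistoryAutonomyComparisonAgeCompositionYoungestTailSumFlow
  (kernel_entry_le row_mass_le)
open Summit.QuantumFields.BalabanUV.Beta.EriceRemainderEnclosureHistoryAutonomyComparisonAgeCompositionChainWiring (aggregate_eq_sum)
open Summit.QuantumFields.BalabanUV.Beta.EriceRemainderEnclosureHistoryAutonomyComparisonAgeCompositionTwoAgesOldRead (old_read_variation)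
open Summit.QuantumFields.BalabanUV.Beta.EriceRemainderEnclosureHistoryAutonomyComparisonAgeCompositionNestedReads (renewal_bounds_of_step)
open Summit.QuantumFields.BalabanUV.Beta.EriceRemainderEnclosureHistoryAutonomyComparisonAgeCompositionNestedMoments
  (residual_step_moment row_moment_le sum_range_succ_real)
variable {B : (ℕ → ℝ) → ℝ} {γ b gIR : ℝ} {L : ℕ → ℝ} {K : ℕ} {h g : ℕ → ℝ}

/-! ## §1 The own-window cap and the young-pair polytope -/

/-- `t·(3a − t)² ≤ 4a³` for `t ≤ 4a`: `4a³ − t(3a−t)² = (a−t)²(4a−t)`. [folklore] -/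
theorem cube_tangent_poly {a t : ℝ} (hta : t ≤ 4 * a) : t * (3 * a - t) ^ 2 ≤ 4 * a ^ 3 := by
  nlinarith [mul_nonneg (sq_nonneg (a - t)) (sub_nonneg.2 hta)]

/-- THE TANGENT TERM: if `k·h₀² ≤ t·w²` (the ray bound at distance `t` inside the window), `c²·a ≤ k`, `w ≥ 0` and `t ≤ 3a` (`a > 0`), then
`c·(3a − t)·h₀ ≤ 2a·w` — the tangent of `t ↦ t^{-1∕2}` at `a` under the chord, squared away. [folklore] -/
theorem tangent_term_le {a c t k h₀ w : ℝ} (ha : 0 < a) (ht3 : t ≤ 3 * a) (hca : c ^ 2 * a ≤ k)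
    (hw : 0 ≤ w) (hray : k * h₀ ^ 2 ≤ t * w ^ 2) : c * (3 * a - t) * h₀ ≤ 2 * a * w := by
  have e1 : t * (3 * a - t) ^ 2 ≤ 4 * a ^ 3 := cube_tangent_poly (by linarith)
  have h1 : k * h₀ ^ 2 * (3 * a - t) ^ 2 ≤ t * w ^ 2 * (3 * a - t) ^ 2 := mul_le_mul_of_nonneg_right hray (sq_nonneg _)
  have h2 : w ^ 2 * (t * (3 * a - t) ^ 2) ≤ w ^ 2 * (4 * a ^ 3) := mul_le_mul_of_nonneg_left e1 (sq_nonneg _)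
  have h3 : c ^ 2 * a * ((3 * a - t) ^ 2 * h₀ ^ 2) ≤ k * ((3 * a - t) ^ 2 * h₀ ^ 2) :=
    mul_le_mul_of_nonneg_right hca (by positivity)
  have h4 : a * (c * (3 * a - t) * h₀) ^ 2 ≤ a * (2 * a * w) ^ 2 := by nlinarith [h1, h2, h3]
  exact le_of_pow_le_pow_left₀ two_ne_zero (by positivity) (le_of_mul_le_mul_left h4 ha)

/-- `Σ_{q<k} (3a − (k+1+q)) = 2a·k` for `a = (3k+1)∕2` ((E92c) `sum_range_succ_real`). [folklore] -/
theorem sum_three_half_sub (k : ℕ) :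
    ∑ q ∈ range k, (3 * ((3 * (k : ℝ) + 1) / 2) - ((k : ℝ) + 1 + q)) = 2 * ((3 * (k : ℝ) + 1) / 2) * k := by
  have hs := sum_range_succ_real k
  have e : ∀ q : ℕ, (3 * ((3 * (k : ℝ) + 1) / 2) - ((k : ℝ) + 1 + q)) = (3 * ((3 * (k : ℝ) + 1) / 2) - k) - ((q : ℝ) + 1) := fun q => by ring
  rw [sum_congr rfl fun q _ => e q, sum_sub_distrib, sum_const, card_range, hs, nsmul_eq_mul]
  ring

/-- **THE OWN-WINDOW LEVELS UNDER THE RAY.**  `B` an isotone memory with floor `b > 0`, `h` a box solution, an age `k ≥ 1`, any real `c` with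
`c²(3k+1) ≤ 2k`: `c·k·h_{m+k} ≤ Σ_{q<k} h_{m+k+1+q}` — every level in `(m+k, m+2k]` lies under the ray from the pin, `k·h_{m+k}² ≤ (k+t)h_{m+k+t}²`
((E90b) `mul_sq_le_from_pin`), and `Σ_{t∈(k,2k]} √(k∕t) ≥ k√(2k∕(3k+1))` by the tangent of `t^{-1∕2}` at the window's mean `(3k+1)∕2`. [folklore] -/
theorem window_sum_ge (hmono : ∀ u v : ℕ → ℝ, SeqBox γ u → SeqBox γ v → (∀ j, u j ≤ v j) → B u ≤ B v) (hb : 0 < b)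
    (hlo : ∀ u, SeqBox γ u → b ≤ B u) (hh : SeqBox γ h) (hf : MemFlow B gIR h) {k : ℕ} (hk : 1 ≤ k) {c : ℝ}
    (hc : c ^ 2 * (3 * (k : ℝ) + 1) ≤ 2 * k) (m : ℕ) : c * k * h (m + k) ≤ ∑ q ∈ range k, h (m + k + 1 + q) := by
  have hpos : ∀ n, 0 < h n := fun n => (hh n).1
  have hkr : (1 : ℝ) ≤ k := by exact_mod_cast hk
  obtain ⟨a, ha_def⟩ : ∃ a : ℝ, a = (3 * (k : ℝ) + 1) / 2 := ⟨_, rfl⟩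
  have ha : 0 < a := by rw [ha_def]; positivity
  have hca : c ^ 2 * a ≤ k := by rw [ha_def]; nlinarith [hc]
  have hs3 := sum_three_half_sub k
  rw [← ha_def] at hs3
  have per : ∀ q ∈ range k, c * (3 * a - ((k : ℝ) + 1 + q)) / (2 * a) * h (m + k) ≤ h (m + k + 1 + q) := by
    intro q hq
    have hqk : (q : ℝ) + 1 ≤ k := by exact_mod_cast Nat.succ_le_of_lt (mem_range.mp hq)
    have hray := mul_sq_le_from_pin hmono hb hlo hh hf m k (q + 1)
    rw [show m + k + (q + 1) = m + k + 1 + q by ring] at hray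
    push_cast at hray
    have := tangent_term_le ha (t := (k : ℝ) + 1 + q) (h₀ := h (m + k)) (by rw [ha_def]; linarith) hca
      (hpos (m + k + 1 + q)).le (by linarith [hray])
    rw [div_mul_eq_mul_div, div_le_iff₀ (by positivity)]
    linarith
  calc c * k * h (m + k) = c / (2 * a) * (2 * a * k) * h (m + k) := by field_simp
    _ = c / (2 * a) * (∑ q ∈ range k, (3 * a - ((k : ℝ) + 1 + q))) * h (m + k) := by rw [hs3]
    _ = ∑ q ∈ range k, c * (3 * a - ((k : ℝ) + 1 + q)) / (2 * a) * h (m + k) := by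
        rw [mul_sum, sum_mul]; exact sum_congr rfl fun q _ => by ring
    _ ≤ ∑ q ∈ range k, h (m + k + 1 + q) := sum_le_sum per

/-- **THE OWN-WINDOW CAP**: along every admissible flow (isotone memory with floor `b > 0` dominating the profile `L ≥ 0`), every age `1 ≤ k < K` has
`x_k(m) = k·L_kh_{m+k}³∕2 ≤ so` at every pin for every `so > 0` with `8k·so² ≥ 3k+1` — `so = 0.6142` serves every `k ≥ 56`, `so² = (3k+1)∕(8k) → 3∕8`;
compare the young age's sharp `√2∕2` ((E89b)).  The `k` reads of the age inside its own window `[m, m+k)` sum to at most the rise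
`1∕h_{m+k}² − 1∕h_m²` ((E88d)) and each reads a level under the ray (`window_sum_ge` with `c = 1∕(2so)`). [folklore] -/
theorem load_le_of_sq (hmono : ∀ u v : ℕ → ℝ, SeqBox γ u → SeqBox γ v → (∀ j, u j ≤ v j) → B u ≤ B v)
    (hL : ∀ k, 0 ≤ L k) (hb : 0 < b) (hlo : ∀ u, SeqBox γ u → b ≤ B u) (hdom : ∀ u, SeqBox γ u → ∑ k ∈ range K, L k * u k ≤ B u)
    (hh : SeqBox γ h) (hf : MemFlow B gIR h) {k : ℕ} (hk : 1 ≤ k) (hkK : k < K) {so : ℝ} (hso : 0 < so)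
    (hsq : 3 * (k : ℝ) + 1 ≤ 8 * k * so ^ 2) (m : ℕ) : (k : ℝ) * (L k * h (m + k) ^ 3 / 2) ≤ so := by
  have hpos : ∀ n, 0 < h n := fun n => (hh n).1
  have hmk := hpos (m + k)
  -- the window letter: L_k·Σ_{q<k} h_{m+k+1+q} ≤ 1∕h_{m+k}²
  have hwin : L k * ∑ q ∈ range k, h (m + k + 1 + q) ≤ 1 / h (m + k) ^ 2 := by
    have h1 := invSq_sub_ge_all_reads hdom hh hf m k
    have h2 : ∑ q ∈ range k, L k * h (m + q + 1 + k) ≤ ∑ q ∈ range k, ∑ i ∈ range K, L i * h (m + q + 1 + i) :=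
      sum_le_sum fun q _ => single_le_sum (f := fun i => L i * h (m + q + 1 + i)) (fun i _ => mul_nonneg (hL i) (hpos _).le) (mem_range.mpr hkK)
    have h3 : 0 < 1 / h m ^ 2 := by have := hpos m; positivity
    rw [mul_sum]
    calc ∑ q ∈ range k, L k * h (m + k + 1 + q) = ∑ q ∈ range k, L k * h (m + q + 1 + k) :=
          sum_congr rfl fun q _ => by rw [show m + k + 1 + q = m + q + 1 + k by ring]
      _ ≤ 1 / h (m + k) ^ 2 := by linarith
  -- the ray: (1∕(2so))·k·h_{m+k} ≤ Σ
  have hc : (1 / (2 * so)) ^ 2 * (3 * (k : ℝ) + 1) ≤ 2 * k := by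
    rw [div_pow, one_pow, div_mul_eq_mul_div, one_mul, div_le_iff₀ (by positivity)]; nlinarith [hsq]
  have hray := window_sum_ge hmono hb hlo hh hf hk hc m
  have h4 : L k * (1 / (2 * so) * k * h (m + k)) ≤ 1 / h (m + k) ^ 2 := (mul_le_mul_of_nonneg_left hray (hL k)).trans hwin
  rw [le_div_iff₀ (pow_pos hmk 2)] at h4
  have e : L k * (1 / (2 * so) * k * h (m + k)) * h (m + k) ^ 2 = ((k : ℝ) * (L k * h (m + k) ^ 3 / 2)) / so := by
    field_simp
  rw [e, div_le_iff₀ hso, one_mul] at h4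
  exact h4

/-- **THE YOUNG-PAIR POLYTOPE AT A PIN.**  Ages `1 < j < K` loaded (any others allowed, `L ≥ 0`); `σ = h_{m+1}∕h_{m+j}`, `x = L_1h_{m+1}³∕2`,
`y = j·L_jh_{m+j}³∕2`; rational-friendly constants `ρ, ζ` with `ρ²(j+1) ≤ j`, `ζ²(3j+1) ≤ 8j`.  Then `1 ≤ σ`, `σ² ≤ j` (the ray from the pin),
the STEP letter `1.41421·x + (2ρ∕j)σ²·y ≤ 1` (the step at `m` dominates `L_1h_{m+2} + L_jh_{m+j+1}`, `h_{m+1}² ≤ 2h_{m+2}²`, `jh_{m+j}² ≤ (j+1)h_{m+j+1}²`)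
and the WINDOW letter `2(j−1+ρ)·x + ζσ³·y ≤ σ³` (the rise over `[m, m+j)` dominates the young reads `≥ L_1h_{m+j}(j−1+ρ)` and the middle's own-window
reads `≥ L_j·(ζj∕2)h_{m+j}`). [folklore] -/
theorem young_pair_letters (hmono : ∀ u v : ℕ → ℝ, SeqBox γ u → SeqBox γ v → (∀ j, u j ≤ v j) → B u ≤ B v)
    (hL : ∀ k, 0 ≤ L k) (hb : 0 < b) (hlo : ∀ u, SeqBox γ u → b ≤ B u) (hdom : ∀ u, SeqBox γ u → ∑ k ∈ range K, L k * u k ≤ B u)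
    (hh : SeqBox γ h) (hf : MemFlow B gIR h) {j : ℕ} (hj : 2 ≤ j) (hjK : j < K) {ρ ζ : ℝ} (hρ : ρ ^ 2 * ((j : ℝ) + 1) ≤ j)
    (hζ : ζ ^ 2 * (3 * (j : ℝ) + 1) ≤ 8 * j) (m : ℕ) :
    1 ≤ h (m + 1) / h (m + j) ∧ (h (m + 1) / h (m + j)) ^ 2 ≤ j
    ∧ (141421 : ℝ) / 100000 * (L 1 * h (m + 1) ^ 3 / 2) + 2 * ρ / j * (h (m + 1) / h (m + j)) ^ 2 * ((j : ℝ) * (L j * h (m + j) ^ 3 / 2)) ≤ 1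
    ∧ 2 * ((j : ℝ) - 1 + ρ) * (L 1 * h (m + 1) ^ 3 / 2) + ζ * (h (m + 1) / h (m + j)) ^ 3 * ((j : ℝ) * (L j * h (m + j) ^ 3 / 2))
        ≤ (h (m + 1) / h (m + j)) ^ 3 := by
  have hpos : ∀ n, 0 < h n := fun n => (hh n).1
  have hanti := (strictAnti_of_memFlow hb hlo hh hf).antitone
  have h1K : 1 < K := by omega
  have hjr : (2 : ℝ) ≤ j := by exact_mod_cast hj
  have hm1 := hpos (m + 1); have hmj := hpos (m + j); have hm2 := hpos (m + 2); have hmj1 := hpos (m + j + 1)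
  have hL1 := hL 1; have hLj := hL j
  -- σ ≥ 1 and σ² ≤ j
  have hσ1 : 1 ≤ h (m + 1) / h (m + j) := by rw [le_div_iff₀ hmj, one_mul]; exact hanti (by omega)
  have hσ2 : (h (m + 1) / h (m + j)) ^ 2 ≤ j := by
    have := mul_sq_le_from_pin hmono hb hlo hh hf m 1 (j - 1)
    rw [show m + 1 + (j - 1) = m + j by omega, Nat.cast_sub (by omega : 1 ≤ j)] at this
    push_cast at this
    rw [div_pow, div_le_iff₀ (pow_pos hmj 2)]; linarith
  -- h_{m+2} ≥ 0.707105·h_{m+1} and h_{m+j+1} ≥ ρ·h_{m+j}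
  have h2 : (141421 : ℝ) / 200000 * h (m + 1) ≤ h (m + 2) := by
    have := mul_sq_le_from_pin hmono hb hlo hh hf m 1 1
    push_cast at this
    have hsq : ((141421 : ℝ) / 200000 * h (m + 1)) ^ 2 ≤ h (m + 2) ^ 2 := by rw [mul_pow]; nlinarith [sq_nonneg (h (m + 1))]
    exact le_of_pow_le_pow_left₀ two_ne_zero hm2.le hsq
  have hρj : ρ * h (m + j) ≤ h (m + j + 1) := by
    have := mul_sq_le_from_pin hmono hb hlo hh hf m j 1
    push_cast at this
    have hsq : (ρ * h (m + j)) ^ 2 ≤ h (m + j + 1) ^ 2 := by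
      rw [mul_pow]; nlinarith [mul_le_mul_of_nonneg_right hρ (sq_nonneg (h (m + j)))]
    exact le_of_pow_le_pow_left₀ two_ne_zero hmj1.le hsq
  refine ⟨hσ1, hσ2, ?_, ?_⟩
  · -- the step letter
    have hstep : L 1 * h (m + 2) + L j * h (m + j + 1) ≤ 1 / h (m + 1) ^ 2 := by
      have e1 := invSq_sub_ge_all_reads hdom hh hf m 1
      rw [sum_range_one] at e1
      have e2 := two_terms_le_reads hL hh (show 1 ≠ j by omega) h1K hjK (m + 0 + 1)
      rw [show m + 0 + 1 + 1 = m + 2 by ring, show m + 0 + 1 + j = m + j + 1 by ring] at e2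
      have e3 : 0 < 1 / h m ^ 2 := by have := hpos m; positivity
      linarith
    have hA : (141421 : ℝ) / 100000 * (L 1 * h (m + 1) ^ 3 / 2) ≤ h (m + 1) ^ 2 * (L 1 * h (m + 2)) := by
      have := mul_le_mul_of_nonneg_left h2 (mul_nonneg hL1 (sq_nonneg (h (m + 1))))
      nlinarith [this]
    have hB : 2 * ρ / j * (h (m + 1) / h (m + j)) ^ 2 * ((j : ℝ) * (L j * h (m + j) ^ 3 / 2)) ≤ h (m + 1) ^ 2 * (L j * h (m + j + 1)) := by
      have e : 2 * ρ / j * (h (m + 1) / h (m + j)) ^ 2 * ((j : ℝ) * (L j * h (m + j) ^ 3 / 2)) = h (m + 1) ^ 2 * (L j * (ρ * h (m + j))) := by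
        field_simp
      rw [e]
      exact mul_le_mul_of_nonneg_left (mul_le_mul_of_nonneg_left hρj hLj) (sq_nonneg _)
    have hC : h (m + 1) ^ 2 * (L 1 * h (m + 2)) + h (m + 1) ^ 2 * (L j * h (m + j + 1)) ≤ 1 := by
      rw [← mul_add]
      have := mul_le_mul_of_nonneg_left hstep (sq_nonneg (h (m + 1)))
      rwa [mul_one_div, div_self (pow_pos hm1 2).ne'] at this
    linarith
  · -- the window letter
    have hwin : ∑ q ∈ range j, (L 1 * h (m + q + 2) + L j * h (m + j + 1 + q)) ≤ 1 / h (m + j) ^ 2 := by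
      have e1 := invSq_sub_ge_all_reads hdom hh hf m j
      have e2 : ∑ q ∈ range j, (L 1 * h (m + q + 2) + L j * h (m + j + 1 + q)) ≤ ∑ q ∈ range j, ∑ i ∈ range K, L i * h (m + q + 1 + i) :=
        sum_le_sum fun q _ => by
          have := two_terms_le_reads hL hh (show 1 ≠ j by omega) h1K hjK (m + q + 1)
          rwa [show m + q + 1 + 1 = m + q + 2 by ring, show m + q + 1 + j = m + j + 1 + q by ring] at this
      have e3 : 0 < 1 / h m ^ 2 := by have := hpos m; positivity
      linarith
    rw [sum_add_distrib] at hwin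
    -- young reads: Σ_{q<j} L_1h_{m+q+2} ≥ L_1h_{m+j}(j−1+ρ)
    have hY : L 1 * h (m + j) * ((j : ℝ) - 1 + ρ) ≤ ∑ q ∈ range j, L 1 * h (m + q + 2) := by
      obtain ⟨j', rfl⟩ : ∃ j', j = j' + 1 := ⟨j - 1, by omega⟩
      rw [sum_range_succ, show m + j' + 2 = m + (j' + 1) + 1 by ring]
      have hfirst : ∑ q ∈ range j', L 1 * h (m + (j' + 1)) ≤ ∑ q ∈ range j', L 1 * h (m + q + 2) :=
        sum_le_sum fun q hq => mul_le_mul_of_nonneg_left (hanti (by have := mem_range.mp hq; omega)) hL1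
      rw [sum_const, card_range, nsmul_eq_mul] at hfirst
      have hlast := mul_le_mul_of_nonneg_left hρj hL1
      push_cast
      linarith [hfirst, hlast]
    -- middle reads: Σ_{q<j} L_jh_{m+j+1+q} ≥ L_j·(ζ∕2)·j·h_{m+j}
    have hcζ : (ζ / 2) ^ 2 * (3 * (j : ℝ) + 1) ≤ 2 * j := by nlinarith [hζ]
    have hM : L j * (ζ / 2 * j * h (m + j)) ≤ ∑ q ∈ range j, L j * h (m + j + 1 + q) := by
      rw [← mul_sum]
      exact mul_le_mul_of_nonneg_left (window_sum_ge hmono hb hlo hh hf (by omega) hcζ m) hLj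
    -- assemble and multiply by h_{m+j}²·σ³
    have hsum : L 1 * h (m + j) * ((j : ℝ) - 1 + ρ) + L j * (ζ / 2 * j * h (m + j)) ≤ 1 / h (m + j) ^ 2 := by linarith
    have hσpos : 0 < h (m + 1) / h (m + j) := div_pos hm1 hmj
    have key := mul_le_mul_of_nonneg_left hsum (le_of_lt (mul_pos (pow_pos hmj 2) (pow_pos hσpos 3)))
    have e1 : h (m + j) ^ 2 * (h (m + 1) / h (m + j)) ^ 3 * (1 / h (m + j) ^ 2) = (h (m + 1) / h (m + j)) ^ 3 := by
      field_simp
    have e2 : h (m + j) ^ 2 * (h (m + 1) / h (m + j)) ^ 3 * (L 1 * h (m + j) * ((j : ℝ) - 1 + ρ) + L j * (ζ / 2 * j * h (m + j)))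
        = 2 * ((j : ℝ) - 1 + ρ) * (L 1 * h (m + 1) ^ 3 / 2) + ζ * (h (m + 1) / h (m + j)) ^ 3 * ((j : ℝ) * (L j * h (m + j) ^ 3 / 2)) := by
      field_simp
    rw [e1, e2] at key
    exact key

/-! ## §2 The young pair against the old read, with the three letters -/
set_option maxHeartbeats 400000 in
/-- **THE CENSUS THREE AGES FROM THE YOUNG-PAIR POLYTOPE, THE OWN-WINDOW CAP AND THE FIRST MOMENT (parametric).**  Profile carried by `{1, k₂, k₃}`,
`2 ≤ k₂ < k₃ < K`; dampings of the self-consistent class `g_t(1+F_t) ≥ 1`; constants `ρ, ζ` with `ρ²(k₂+1) ≤ k₂`, `ζ²(3k₂+1) ≤ 8k₂`, `0 < so < 1` with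
`8k₃·so² ≥ 3k₃+1`, `κ` with `4so ≤ κ·k₃`; IF every point of the young-pair polytope — `1 ≤ σ`, `σ² ≤ k₂`, `x, y ≥ 0`, `1.41421x + (2ρ∕k₂)σ²y ≤ 1`,
`2(k₂−1+ρ)x + ζσ³y ≤ σ³` — satisfies `(1−so)(x+y) + κ(x + (k₂+1)y∕2) ≤ 1 − so`, THEN `0 ≤ ε ≤ e` at every pin, every horizon, every admissible excess.
At the pin: `e − O ≥ (1 − x₃)e ≥ (1−so)e` (old row mass ≤ `x₃ ≤ so`, `load_le_of_sq`); the pair's rows have mass `≤ x + y` and first moment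
`≤ x + (k₂+1)y∕2` ((E92c) `row_moment_le`), the old read varies by `≤ 4d·c₃e ≤ (4so∕k₃)·d·e` over `d ≤ k₂` lags ((E91a)); (E92c) `residual_step_moment`
gives `ε ≥ [(1−x−y)(1−so) − κ(x + (k₂+1)y∕2)]·e ≥ 0`. [folklore] -/
theorem flow_nonneg_three_ages_young_pair_moment (hmono : ∀ u v : ℕ → ℝ, SeqBox γ u → SeqBox γ v → (∀ j, u j ≤ v j) → B u ≤ B v)
    (hL : ∀ k, 0 ≤ L k) (hb : 0 < b) (hlo : ∀ u, SeqBox γ u → b ≤ B u) (hdom : ∀ u, SeqBox γ u → ∑ k ∈ range K, L k * u k ≤ B u)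
    (hh : SeqBox γ h) (hf : MemFlow B gIR h) (hg : ∀ t, 0 < g t ∧ g t ≤ 1)
    (hgF : ∀ t, 1 ≤ g t * (1 + ∑ k ∈ range K, L k * h (t + k) ^ 3 / 2))
    {k₂ k₃ : ℕ} (hk2 : 2 ≤ k₂) (hk23 : k₂ < k₃) (hk3K : k₃ < K) (hL3 : ∀ j, j < K → j ≠ 1 → j ≠ k₂ → j ≠ k₃ → L j = 0)
    {ρ ζ so κ : ℝ} (hρ : ρ ^ 2 * ((k₂ : ℝ) + 1) ≤ k₂) (hζ : ζ ^ 2 * (3 * (k₂ : ℝ) + 1) ≤ 8 * k₂)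
    (hso0 : 0 < so) (hso1 : so < 1) (hso : 3 * (k₃ : ℝ) + 1 ≤ 8 * k₃ * so ^ 2) (hκ : 4 * so ≤ κ * k₃)
    (hcond : ∀ σ x y : ℝ, 1 ≤ σ → σ ^ 2 ≤ k₂ → 0 ≤ x → 0 ≤ y →
      (141421 : ℝ) / 100000 * x + 2 * ρ / k₂ * σ ^ 2 * y ≤ 1 → 2 * ((k₂ : ℝ) - 1 + ρ) * x + ζ * σ ^ 3 * y ≤ σ ^ 3 →
      (1 - so) * (x + y) + κ * (x + ((k₂ : ℝ) + 1) / 2 * y) ≤ 1 - so)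
    {N : ℕ} {KL : ℕ → ℕ → ℕ → ℝ}
    (hKL : ∀ k n l, KL k n l = if 0 < k ∧ k < K ∧ l < k then L k * h (n + k) ^ 3 / 2 * ∏ t ∈ Ico (n + 1 + l) (n + k + 1), g t else 0)
    {KA : ℕ → ℕ → ℕ → ℝ} {RA : ℕ → (ℕ → ℝ) → ℕ → ℝ}
    (hRA : ∀ i v m, RA i v m = ∑ l ∈ range K, KA i m l * v (m + 1 + l))
    (hKA : ∀ i m l, KA i m l = KL i m l + KA (i + 1) m l) (hKAtop : ∀ m l, KA K m l = 0)
    {e ε : ℕ → ℝ} (he0 : ∀ m, 0 ≤ e m) (hea : ∀ m, e (m + 1) ≤ e m)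
    (hεt : ∀ m, N < m → ε m = 0) (hεrec : ∀ m, ε m = e m - RA 1 ε m) : ∀ m, 0 ≤ ε m ∧ ε m ≤ e m := by
  have hpos : ∀ n, 0 < h n := fun n => (hh n).1
  have hK : 1 ≤ K := by omega
  have h1K : 1 < K := by omega
  have hk2K : k₂ < K := by omega
  have hj : 0 < k₂ := by omega
  have hk : 0 < k₃ := by omega
  have hL0 : L 0 = 0 := hL3 0 (by omega) (by omega) (by omega) (by omega)
  have hjr : (2 : ℝ) ≤ k₂ := by exact_mod_cast hk2
  have hkr : (0 : ℝ) < k₃ := by exact_mod_cast hk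
  have hκ0 : 0 ≤ κ := by
    by_contra hneg
    have : κ * k₃ < 0 := mul_neg_of_neg_of_pos (not_le.mp hneg) hkr
    linarith
  have hea' : ∀ p q, p ≤ q → e q ≤ e p := by
    intro p q hpq
    induction q, hpq using Nat.le_induction with
    | base => exact le_rfl
    | succ q _ ih => exact (hea q).trans ih
  -- the aggregate row is the young pair's rows plus the old row
  have hKA1 : ∀ m l, KA 1 m l = (KL 1 m l + KL k₂ m l) + KL k₃ m l := by
    intro m l
    have h1 : KA 1 m l = ∑ k' ∈ Ico 1 (K - 1 + 1), KL k' m l :=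
      aggregate_eq_sum (n := K - 1) hKA (fun m l => by rw [Nat.sub_add_cancel hK]; exact hKAtop m l) (show 1 ≤ K - 1 + 1 by omega) m l
    rw [h1, Nat.sub_add_cancel hK]
    have hsub : ({1, k₂, k₃} : Finset ℕ) ⊆ Ico 1 K := by
      intro x hx
      simp only [mem_insert, mem_singleton] at hx
      rw [mem_Ico]; rcases hx with rfl | rfl | rfl <;> omega
    rw [← sum_subset hsub (fun x hx hxn => by
      simp only [mem_insert, mem_singleton, not_or] at hxn
      rw [hKL]
      split_ifs
      · rw [hL3 x (mem_Ico.mp hx).2 hxn.1 hxn.2.1 hxn.2.2]; simp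
      · rfl), sum_insert (by simp only [mem_insert, mem_singleton]; omega), sum_pair (by omega)]
    ring
  have hrec2 : ∀ p, ε p = e p - ∑ l ∈ range K, (KL 1 p l + KL k₂ p l) * ε (p + 1 + l) - ∑ l ∈ range K, KL k₃ p l * ε (p + 1 + l) := by
    intro p
    rw [hεrec p, hRA]
    have : ∑ l ∈ range K, KA 1 p l * ε (p + 1 + l)
        = ∑ l ∈ range K, (KL 1 p l + KL k₂ p l) * ε (p + 1 + l) + ∑ l ∈ range K, KL k₃ p l * ε (p + 1 + l) := by
      rw [← sum_add_distrib]; exact sum_congr rfl fun l _ => by rw [hKA1]; ring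
    rw [this]; ring
  refine renewal_bounds_of_step he0 hεt fun m IH => ?_
  have hreadY0 : ∀ p, m ≤ p → 0 ≤ ∑ l ∈ range K, (KL 1 p l + KL k₂ p l) * ε (p + 1 + l) := fun p hp =>
    sum_nonneg fun l _ => mul_nonneg (add_nonneg (kernel_entry_le hL hh hg hKL 1 p l).1 (kernel_entry_le hL hh hg hKL k₂ p l).1)
      (IH _ (by omega)).1
  have hreadO0 : ∀ p, m ≤ p → 0 ≤ ∑ l ∈ range K, KL k₃ p l * ε (p + 1 + l) := fun p hp =>
    sum_nonneg fun l _ => mul_nonneg (kernel_entry_le hL hh hg hKL k₃ p l).1 (IH _ (by omega)).1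
  -- the letters at the pin
  set c1 := L 1 * h (m + 1) ^ 3 / 2 with hc1_def
  set c2 := L k₂ * h (m + k₂) ^ 3 / 2 with hc2_def
  set c3 := L k₃ * h (m + k₃) ^ 3 / 2 with hc3_def
  have hc10 : 0 ≤ c1 := by have := hL 1; have := hpos (m + 1); positivity
  have hc20 : 0 ≤ c2 := by have := hL k₂; have := hpos (m + k₂); positivity
  have hc30 : 0 ≤ c3 := by have := hL k₃; have := hpos (m + k₃); positivity
  have hx3 : (k₃ : ℝ) * c3 ≤ so := load_le_of_sq hmono hL hb hlo hdom hh hf (by omega) hk3K hso0 hso m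
  obtain ⟨hσ1, hσ2, hP1, hP2⟩ := young_pair_letters hmono hL hb hlo hdom hh hf hk2 hk2K hρ hζ m
  set σ := h (m + 1) / h (m + k₂) with hσ_def
  have hfin := hcond σ c1 ((k₂ : ℝ) * c2) hσ1 hσ2 hc10 (by positivity) hP1 hP2
  have hem := he0 m
  -- STEP 1: the old residual e − O ≥ (1 − x₃)e ≥ (1 − so)e ≥ 0
  have hOle : ∑ l ∈ range K, KL k₃ m l * ε (m + 1 + l) ≤ (k₃ : ℝ) * c3 * e m := by
    calc ∑ l ∈ range K, KL k₃ m l * ε (m + 1 + l) ≤ ∑ l ∈ range K, KL k₃ m l * e m :=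
          sum_le_sum fun l _ => mul_le_mul_of_nonneg_left
            (((IH _ (by omega)).2).trans (hea' m (m + 1 + l) (by omega))) (kernel_entry_le hL hh hg hKL k₃ m l).1
      _ = (∑ l ∈ range K, KL k₃ m l) * e m := by rw [sum_mul]
      _ ≤ (k₃ : ℝ) * c3 * e m := mul_le_mul_of_nonneg_right (row_mass_le hL hh hg hKL hk3K m) hem
  have hres1 : (1 - so) * e m ≤ e m - ∑ l ∈ range K, KL k₃ m l * ε (m + 1 + l) := by
    have := mul_le_mul_of_nonneg_right hx3 hem
    linarith only [hOle, this]
  have hres1' : 0 ≤ e m - ∑ l ∈ range K, KL k₃ m l * ε (m + 1 + l) := le_trans (mul_nonneg (by linarith) hem) hres1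
  -- STEP 2: the young pair against the old read, first moment x + (k₂+1)y∕2, variation 4c₃ per lag
  have hWy : ∑ l ∈ range K, (KL 1 m l + KL k₂ m l) ≤ c1 + (k₂ : ℝ) * c2 := by
    rw [sum_add_distrib]
    have h1 : ∑ l ∈ range K, KL 1 m l ≤ c1 := by have := row_mass_le hL hh hg hKL h1K m; simpa using this
    have h2 : ∑ l ∈ range K, KL k₂ m l ≤ (k₂ : ℝ) * c2 := row_mass_le hL hh hg hKL hk2K m
    linarith
  have hMy : ∑ l ∈ range K, (KL 1 m l + KL k₂ m l) * ((l : ℝ) + 1) ≤ c1 + ((k₂ : ℝ) + 1) / 2 * ((k₂ : ℝ) * c2) := by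
    simp_rw [add_mul]
    rw [sum_add_distrib]
    have h1 := row_moment_le hL hh hg hKL h1K m
    have h2 := row_moment_le hL hh hg hKL hk2K m
    rw [← hc1_def] at h1
    rw [← hc2_def] at h2
    norm_num at h1
    have e : c2 * ((k₂ : ℝ) * ((k₂ : ℝ) + 1) / 2) = ((k₂ : ℝ) + 1) / 2 * ((k₂ : ℝ) * c2) := by ring
    linarith
  have hstep := residual_step_moment (i := k₂) (Kw := K) (m := m) (sy := c1 + (k₂ : ℝ) * c2) (V := 4 * c3)
    (M₁ := c1 + ((k₂ : ℝ) + 1) / 2 * ((k₂ : ℝ) * c2))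
    (wy := fun l => KL 1 m l + KL k₂ m l) (O := fun p => ∑ l ∈ range K, KL k₃ p l * ε (p + 1 + l)) (e := e) (ε := ε)
    (fun l => add_nonneg (kernel_entry_le hL hh hg hKL 1 m l).1 (kernel_entry_le hL hh hg hKL k₂ m l).1)
    (fun l hl => by rw [hKL, if_neg (by omega), hKL, if_neg (by omega), add_zero])
    hWy hMy (by positivity) he0 hea
    (fun q hq => by
      have := hrec2 q
      have h1 := hreadY0 q hq.le
      linarith only [this, h1])
    hres1'
    (fun d hd1 hdj => by
      have hdk : d ≤ k₃ := by omega
      have hv' := old_read_variation hmono hL hb hlo hdom hh hf hL0 hg hgF hKL hk hk3K hd1 hdk he0 hea IH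
      rw [← hc3_def] at hv'
      linarith only [hv'])
  -- assemble
  have hεm := hrec2 m
  refine ⟨?_, ?_⟩
  · have hsy1 : 0 ≤ 1 - (c1 + (k₂ : ℝ) * c2) := by
      have : 0 ≤ κ * (c1 + ((k₂ : ℝ) + 1) / 2 * ((k₂ : ℝ) * c2)) := by positivity
      nlinarith [hfin, this]
    have h1 := mul_le_mul_of_nonneg_left hres1 hsy1
    -- M₁·4c₃ ≤ κ·M₁ (4c₃ ≤ 4so∕k₃ ≤ κ)
    have hc3' : 4 * c3 ≤ κ := by
      have : 4 * ((k₃ : ℝ) * c3) ≤ κ * k₃ := by linarith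
      by_contra hneg
      have : κ * k₃ < 4 * c3 * k₃ := mul_lt_mul_of_pos_right (not_le.mp hneg) hkr
      linarith
    have h2 : (c1 + ((k₂ : ℝ) + 1) / 2 * ((k₂ : ℝ) * c2)) * (4 * c3) * e m ≤ κ * (c1 + ((k₂ : ℝ) + 1) / 2 * ((k₂ : ℝ) * c2)) * e m := by
      have := mul_le_mul_of_nonneg_left hc3' (show 0 ≤ c1 + ((k₂ : ℝ) + 1) / 2 * ((k₂ : ℝ) * c2) by positivity)
      nlinarith [this, hem]
    have h3 : 0 ≤ ((1 - so) * (1 - (c1 + (k₂ : ℝ) * c2)) - κ * (c1 + ((k₂ : ℝ) + 1) / 2 * ((k₂ : ℝ) * c2))) * e m :=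
      mul_nonneg (by linarith) hem
    rw [hεm]
    linarith [hstep, h1, h2, h3]
  · rw [hεm]
    linarith only [hreadY0 m le_rfl, hreadO0 m le_rfl]

end Summit.QuantumFields.BalabanUV.Beta.EriceRemainderEnclosureHistoryAutonomyComparisonAgeCompositionYoungPairMoment

end
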